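import Summits.CriticalPhenomena.Ising3DConformalLimit.Theses.SubPtolemyInterlacing
import Literature.Probability.LatticeModels.CriticalCorrWellDefined
import Literature.Probability.LatticeModels.MagnetizationExponentUpperProofs
import Literature.Probability.LatticeModels.CriticalTwoPointLower
import HarnessLib

/-!
# `SubPtolemyInterlacing.SubcriticalSuffices` (item stmt-CriticalPhenomena-15706), proved

THEOREM-ONLY file (no definitions, no named facts). The support item of route
`SubPtolemyInterlacing` of the sub-problem `Ising3DConformalLimit`:

`InterlacingSubcritical → Interlacing` — the sub-Ptolemy (interlacing) inequality for the
plus-state correlations on axis quadruples, assumed for all `0 ≤ β < β_c(3)`, passes to the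
critical correlators `criticalCorr 3` at `β = β_c(3)`.

Proof (all inputs are theorems of the tree):

* **left-continuity of the plus state at `β_c(3)`** (`plusCorr_tendsto_criticalBeta_three_left`):
  for `0 ≤ β ≤ β_c`, `⟨σ_A⟩^∅_β ≤ ⟨σ_A⟩⁺_β ≤ ⟨σ_A⟩⁺_{β_c}` (`freeCorr_le_plusCorr`,
  `plusCorr_mono_params`, GKS); the free state is left-continuous in `β`
  (`freeCorr_continuousWithinAt_Iic`, Aizenman–Duminil-Copin–Sidoravicius 2015, §3.3); and
  `⟨σ_A⟩^∅_{β_c} = ⟨σ_A⟩⁺_{β_c}` because `m*(β_c(3)) = 0`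
  (`freeCorr_eq_plusCorr_of_spontaneousMagnetization_eq_zero`,
  `spontaneousMagnetization_criticalBeta_eq_zero_holds`, ADS 2015 Thm. 1.2); squeeze along
  `𝓝[<] β_c`, which is a proper filter since `β_c(3) > 0` (`criticalBeta_pos_holds`);
* the non-strict product inequality passes to the limit `β ↑ β_c` (`le_of_tendsto_of_tendsto`);
* the critical correlator of an injective tuple is the plus-state correlation of its set of
  sites (`spinMonomial` of distinct sites `=` `spinProduct`), and the axis sites `k • e₁`,
  `k ∈ {0, a, a+b, a+b+c}`, are pairwise distinct for `a, b, c ≥ 1`.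
-/

namespace Summit.CriticalPhenomena.Ising3DConformalLimit.Theorems

open Filter Topology
open Literature.Probability.LatticeModels
open Summit.CriticalPhenomena.Ising3DConformalLimit.Theses

/-- **Left-continuity of the plus state at `β_c(3)`**: for every finite `A ⊆ ℤ³`,
`⟨σ_A⟩⁺_{β,0} → ⟨σ_A⟩⁺_{β_c,0}` as `β ↑ β_c(3)`. Squeeze between the free state (left-continuous,
`freeCorr_continuousWithinAt_Iic`, and equal to the plus state at `β_c` since `m*(β_c) = 0` in
`d = 3`, Aizenman–Duminil-Copin–Sidoravicius 2015) and the constant `⟨σ_A⟩⁺_{β_c,0}` (GKS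
monotonicity in `β`, `plusCorr_mono_params`). [cite: AizenmanDuminilCopinSidoraviciusCMP2015, Thm. 1.2 with Cor. 1.5 (1) and §3.3] [cite: FriedliVelenik2017, Exercise 3.16, p. 115, and Lemma 3.31, p. 119] -/
theorem plusCorr_tendsto_criticalBeta_three_left (A : Finset (Site 3)) :
    Tendsto (fun β => plusCorr 3 β 0 A) (𝓝[<] criticalBeta 3)
      (𝓝 (plusCorr 3 (criticalBeta 3) 0 A)) := by
  have hβc : 0 < criticalBeta 3 := criticalBeta_pos_holds (d := 3) (by norm_num)
  have hm : spontaneousMagnetization 3 (criticalBeta 3) = 0 :=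
    spontaneousMagnetization_criticalBeta_eq_zero_holds (d := 3) (by norm_num)
  have heq : freeCorr 3 (criticalBeta 3) 0 A = plusCorr 3 (criticalBeta 3) 0 A :=
    freeCorr_eq_plusCorr_of_spontaneousMagnetization_eq_zero hβc.le hm A
  -- the free state tends to `⟨σ_A⟩^∅_{β_c} = ⟨σ_A⟩⁺_{β_c}` from the left
  have hfree : Tendsto (fun β => freeCorr 3 β 0 A) (𝓝[<] criticalBeta 3)
      (𝓝 (plusCorr 3 (criticalBeta 3) 0 A)) := by
    have h := (freeCorr_continuousWithinAt_Iic (d := 3) (h := 0) le_rfl A hβc).tendsto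
    rw [heq] at h
    exact h.mono_left (nhdsWithin_mono _ Set.Iio_subset_Iic_self)
  have hpos : ∀ᶠ β in 𝓝[<] criticalBeta 3, 0 ≤ β :=
    mem_nhdsWithin_of_mem_nhds (eventually_ge_nhds hβc)
  have hlt : ∀ᶠ β in 𝓝[<] criticalBeta 3, β < criticalBeta 3 := self_mem_nhdsWithin
  refine tendsto_of_tendsto_of_tendsto_of_le_of_le' hfree tendsto_const_nhds ?_ ?_
  · filter_upwards [hpos] with β hβ using freeCorr_le_plusCorr hβ le_rfl A
  · filter_upwards [hpos, hlt] with β hβ hβlt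
    exact plusCorr_mono_params hβ hβlt.le le_rfl le_rfl A

/-- The critical four-point correlator of four pairwise distinct sites is the critical plus-state
correlation of the corresponding four-element set (`∏ᵢ σ_{xᵢ} = σ_{{x₀,x₁,x₂,x₃}}`). [folklore] -/
theorem criticalCorr_four_eq_plusCorr_of_ne {x₀ x₁ x₂ x₃ : Site 3} (h01 : x₀ ≠ x₁) (h02 : x₀ ≠ x₂)
    (h03 : x₀ ≠ x₃) (h12 : x₁ ≠ x₂) (h13 : x₁ ≠ x₃) (h23 : x₂ ≠ x₃) :
    criticalCorr 3 4 ![x₀, x₁, x₂, x₃] = plusCorr 3 (criticalBeta 3) 0 {x₀, x₁, x₂, x₃} := by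
  show plusExpect 3 (criticalBeta 3) 0 (spinMonomial ![x₀, x₁, x₂, x₃]) = _
  unfold plusCorr
  congr 1
  funext s
  unfold spinMonomial spinProduct
  rw [Fin.prod_univ_four, Finset.prod_insert (by simp [h01, h02, h03]),
    Finset.prod_insert (by simp [h12, h13]), Finset.prod_pair h23]
  simp only [Matrix.cons_val_zero, Matrix.cons_val_one, Matrix.cons_val]
  ring

/-- The critical two-point correlator of two distinct sites is the critical plus-state correlation
of the pair (`σ_x σ_y = σ_{{x,y}}`). [folklore] -/
theorem criticalCorr_two_eq_plusCorr_of_ne {x y : Site 3} (hxy : x ≠ y) :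
    criticalCorr 3 2 ![x, y] = plusCorr 3 (criticalBeta 3) 0 {x, y} := by
  show plusExpect 3 (criticalBeta 3) 0 (spinMonomial ![x, y]) = _
  unfold plusCorr
  congr 1
  funext s
  unfold spinMonomial spinProduct
  rw [Fin.prod_univ_two, Finset.prod_pair hxy]
  simp only [Matrix.cons_val_zero, Matrix.cons_val_one]

/-- **`SubcriticalSuffices` (item stmt-CriticalPhenomena-15706 of route `SubPtolemyInterlacing`),
proved**: `InterlacingSubcritical → Interlacing`. For `a, b, c ≥ 1` the axis sites
`p k = k • e₁`, `k ∈ {0, a, a+b, a+b+c}`, are pairwise distinct, so every critical correlator in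
`Interlacing` is a plus-state correlation `⟨σ_A⟩⁺_{β_c(3),0}` of a finite set; the subcritical
inequality for `⟨σ_A⟩⁺_{β,0}`, `0 ≤ β < β_c`, passes to `β = β_c` along `β ↑ β_c` by the
left-continuity of the plus state at `β_c(3)` (`plusCorr_tendsto_criticalBeta_three_left`) and
`le_of_tendsto_of_tendsto`. Settles item stmt-CriticalPhenomena-15706 (exact signature). [cite: AizenmanDuminilCopinSidoraviciusCMP2015, Thm. 1.2 with Cor. 1.5 (1)] -/
theorem subcriticalSuffices_proof : SubPtolemyInterlacing.SubcriticalSuffices := by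
  unfold SubPtolemyInterlacing.SubcriticalSuffices SubPtolemyInterlacing.Interlacing
  intro hsub a b c ha hb hc p
  have hβc : 0 < criticalBeta 3 := criticalBeta_pos_holds (d := 3) (by norm_num)
  -- the axis sites are pairwise distinct
  have hp : Function.Injective p := by
    intro j k hjk
    have h0 := congrFun hjk 0
    simp only [p, Pi.smul_apply, Pi.single_eq_same, smul_eq_mul, mul_one, Nat.cast_inj] at h0
    exact h0
  have h1 : p 0 ≠ p a := hp.ne (by omega)
  have h2 : p 0 ≠ p (a + b) := hp.ne (by omega)
  have h3 : p 0 ≠ p (a + b + c) := hp.ne (by omega)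
  have h4 : p a ≠ p (a + b) := hp.ne (by omega)
  have h5 : p a ≠ p (a + b + c) := hp.ne (by omega)
  have h6 : p (a + b) ≠ p (a + b + c) := hp.ne (by omega)
  rw [criticalCorr_four_eq_plusCorr_of_ne h1 h2 h3 h4 h5 h6,
    criticalCorr_two_eq_plusCorr_of_ne h2, criticalCorr_two_eq_plusCorr_of_ne h5,
    criticalCorr_two_eq_plusCorr_of_ne h1, criticalCorr_two_eq_plusCorr_of_ne h6,
    criticalCorr_two_eq_plusCorr_of_ne h3, criticalCorr_two_eq_plusCorr_of_ne h4]
  -- pass the subcritical inequality to the limit `β ↑ β_c(3)`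
  have T := fun A : Finset (Site 3) => plusCorr_tendsto_criticalBeta_three_left A
  refine le_of_tendsto_of_tendsto
    ((T _).mul ((T _).mul (T _))) (((T _).mul (T _)).mul ((T _).mul (T _))) ?_
  have hpos : ∀ᶠ β in 𝓝[<] criticalBeta 3, 0 ≤ β :=
    mem_nhdsWithin_of_mem_nhds (eventually_ge_nhds hβc)
  have hlt : ∀ᶠ β in 𝓝[<] criticalBeta 3, β < criticalBeta 3 := self_mem_nhdsWithin
  filter_upwards [hpos, hlt] with β hβ hβlt
  exact hsub β hβ hβlt a b c ha hb hc

end Summit.CriticalPhenomena.Ising3DConformalLimit.Theorems
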